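/-
Copyright (c) 2026 the pub-hodgecm-mathlib formalisation cell (harness21).  Prover seat hodgecm-mathlib-LH7-p07 (g0), Track A «(D-RAM) FOUR-FRAME» squad, helper lane on
h413 = stmt-HodgeConjecture-24833 (count-neutral).  β-BOARD v1 (sub-dealer LH4-p05 (g8)) RULING 15:31:23Z on ROADMAP-R7-TheoremC v1 (LH7-p05 (g0)): bricks L4a + L3c.  2026-09-04.
-/
import Literature.NumberTheory.LocalFields.WildQuadraticDatumNormSignConductor   -- ★ toolkit: `normSign_mul_eq_of_fixed_of_v_sub_one_le`, `normSign_eq_one_of_fixed_of_v_sub_one_le`, `normSign_mul_of_fixed`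
import Mathlib.Algebra.BigOperators.Ring.Finset
import HarnessLib

/-!
# Crux `H413`, line LH4 «(D-RAM) FOUR-FRAME» — β-BOARD R7 «GLUE CLASSES», THEOREM C bricks L4a + L3c: THE `(g, b) ↦ r = g + (1+g)·b` LINEARISATION of the glue window onto
# a complete irredundant residue system of the F-SHELL `{σr = r, |r| = |ϖ|^s, |r + c₀| = |ϖ|^e}`, the three slot identities, and the `aγ`-invisibility

Cell `hodgecm-mathlib` (D-0151), FLOOR 0, crux item H413 = `stmt-HodgeConjecture-24833`, route `HCCMUnconditional`; squad F0∕P3c∕LH4, β-BOARD v1 row R7 (holder LH7-p05 (g0),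
`F0/P3c/LH7/LH7-p05/g0/ROADMAP-R7-TheoremC.v1.LH7p05g0.md` §1 (L3c), §2 (L4a); sub-dealer ruling 15:31:23Z).  THEOREMS ONLY (no `def`, no instance, no notation, no `sorry`,
default heartbeats); ★-only imports; lane `--supports stmt-HodgeConjecture-24833 --as helper`; pays NO row, states NO law.  PURE VALUATION ALGEBRA on one valued field `K`
(`Valued K ℤᵐ⁰`); §3 uses the ramified quadratic datum `(σ, ϖ; d, t)` through the ★ toolkit (`ω = normSign σ`); nothing about lattices.

THE PICTURE (ROADMAP §2).  After the orbit decomposition (LH7-p05, `finsum_labelledOdd_div_relIndex_glued_sep_eq`) and the per-representative class-sign count on `V(1,1,g)` over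
★ PT-3's product transversal `R₀ = A₀ × Aβ × Aγ`, the glue-window table of slot `i` is a DOUBLE sum over the cut classes `g ∈ R″ = {g ∈ R : |g + c₀| = |ϖ|^e}` (`R` = ★ (iv-c)'s
complete irredundant system of the fixed elements of valuation `|ϖ|^s` modulo `𝔭^n`, `s = 2t′`, `n = ρ + 2t′`, `e = 2t′ + E`) and `b = aβ − 1 ∈ B` (a complete irredundant system of the
fixed ball `|b| ≤ |ϖ|^n` modulo `𝔭^N`) of a class function of the single F-variable **`r := g·T_g(aβ) = g + (1+g)·b`** (`T_g(y) = y + g⁻¹(y−1)`).  THIS FILE proves: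
* §1 THE SLOT IDENTITIES (pure `field_simp`): `g·(a + g⁻¹(a−1)) = g + (1+g)(a−1)` (`r = g·T_g(aβ)`), `(1+g)·a = 1 + (g + (1+g)(a−1))` (`(1+g)aβ = 1 + r`),
  `g·g_α·(a + g⁻¹(a−1)) + g_β = g_α·((g + (1+g)(a−1)) + g_β∕g_α)` (the label argument is `g_α·(r + c₀)`, `c₀ = g_β∕g_α`).
* §2 L4a THE LINEARISATION: with `R″ := R.filter (|g + c₀| = |ϖ|^e)` and `S := (R″ ×ˢ B).image (g + (1+g)b)` — `S` is a COMPLETE IRREDUNDANT system of the F-shell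
  `Sh = {σr = r, |r| = |ϖ|^s, |r + c₀| = |ϖ|^e}` modulo `𝔭^N` (`1 ≤ s < n`, `e < n ≤ N`): `glueShell_image_sub` ∕ `_complete` ∕ `_irredundant`, the map is injective on `R″ ×ˢ B`
  (`glueShell_injOn`; key letter `eq_and_eq_of_v_sub_le`: `r(g,b) ≡ r(g′,b′) (𝔭^N) ⇒ g = g′ ∧ b = b′`, reading first modulo `𝔭^n` then dividing by the unit `1+g`), and
  **`sum_sum_glueShell_eq_sum_image`**: `Σ_{g ∈ R″} Σ_{b ∈ B} G(g + (1+g)b) = Σ_{r ∈ S} G(r)` for every `G` — so the window sum IS a single sum over a residue system of `Sh`, to which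
  ★ `sum_normSign_repr_eq_zero`-type character sums (LH4-p14's ★ p861281 (ii), LH7-p07's `GlueClassCharSums`) apply by name.
* §3 L3c THE `aγ`-INVISIBILITY: `normSign_add_eq_of_v_le` (`ω(x + y) = ω(x)` for fixed `x ≠ 0`, `y` with `|y| ≤ |ϖ|^{2d−1}|x|`), `normSign_eq_one_of_mem_deep` (`ω(aγ) = 1` on
  `U_F^{[k]}`, `k ≥ 2d−1`), and `sum_eq_card_mul_of_forall_eq` (the `aγ`-sum of an `aγ`-blind summand is `#Aγ ·` the value at any member).
HONEST LABEL.  Count-neutral bookkeeping; R7 Theorem C, the (β) table, (β-BAL), T₊ stay OPEN; `HC_CM` is proved only modulo the 7 printed citations (2 remaining named inputs: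
hLiu418 = `stmt-HodgeConjecture-24832`, h413 = `stmt-HodgeConjecture-24833`) until rung 0 closes.

## References
* [Serre1979] J.-P. Serre, *Local Fields*, GTM 67 (1979): Ch. II §1 (the ultrametric inequality; residue systems), Ch. V §3 Cor. 3, Ch. XV §2 (the conductor of `ω`).
* [Kottwitz1986BaseChangeUnits] R. E. Kottwitz, *Base change for unit elements of Hecke algebras*, Compositio Math. 60 (1986): §1 pp. 240–241 (the glued lattice classes `g`).
-/

set_option autoImplicit false

noncomputable section

namespace Summit.HodgeConjecture.HodgeConjecture.Cruxes.H413.F0P3cDyRamGlueShellLinearisation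

open WithZero
open scoped Valued
open Literature.NumberTheory.Automorphic.UnitaryThreeFourFrame
open Literature.NumberTheory.LocalFields.WildQuadraticDatum

variable {K : Type} [Field K] [Valued K ℤᵐ⁰]

/-! ## §1  The slot identities of the linearisation `r = g + (1+g)·(aβ − 1)` -/

omit [Valued K ℤᵐ⁰] in
/-- **`r = g·T_g(aβ)`**: `g·(a + g⁻¹(a − 1)) = g + (1 + g)(a − 1)` (`g ≠ 0`; `T_g(y) = y + g⁻¹(y−1)` is ★ PT-3's twist). [cite: Kottwitz1986BaseChangeUnits, §1 pp. 240–241] -/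
theorem mul_twist_eq {g : K} (hg : g ≠ 0) (a : K) : g * (a + g⁻¹ * (a - 1)) = g + (1 + g) * (a - 1) := by
  field_simp
  ring

omit [Valued K ℤᵐ⁰] in
/-- **`(1 + g)·aβ = 1 + r`**: `(1 + g)·a = 1 + (g + (1 + g)(a − 1))`. [cite: Kottwitz1986BaseChangeUnits, §1 pp. 240–241] -/
theorem one_add_mul_eq_one_add (g a : K) : (1 + g) * a = 1 + (g + (1 + g) * (a - 1)) := by
  ring

omit [Valued K ℤᵐ⁰] in
/-- **THE LABEL ARGUMENT IS `g_α·(r + c₀)`**: `g·g_α·(a + g⁻¹(a − 1)) + g_β = g_α·((g + (1 + g)(a − 1)) + g_β∕g_α)` (`g, g_α ≠ 0`; `c₀ = g_β∕g_α`).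
[cite: Kottwitz1986BaseChangeUnits, §1 pp. 240–241] -/
theorem label_arg_eq {g gα : K} (hg : g ≠ 0) (hgα : gα ≠ 0) (gβ a : K) :
    g * gα * (a + g⁻¹ * (a - 1)) + gβ = gα * ((g + (1 + g) * (a - 1)) + gβ / gα) := by
  field_simp
  ring

omit [Valued K ℤᵐ⁰] in
/-- **THE SLOT-0 PRODUCT**: `r·(r + c₀) = c₀²·(h·(h − 1))·…` in the letters `r = c₀(h − 1)`: precisely `(c₀(h−1))·(c₀(h−1) + c₀) = c₀·c₀·((h − 1)·h)` (so `ω(r(r+c₀)) = ω(h(h−1))`,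
a norm `c₀²` apart). [cite: Serre1979, Ch. V §3 Cor. 3] -/
theorem shell_product_eq (c₀ h : K) : (c₀ * (h - 1)) * (c₀ * (h - 1) + c₀) = c₀ * c₀ * ((h - 1) * h) := by
  ring

/-! ## §2  L4a — the `(g, b) ↦ g + (1+g)·b` linearisation onto a residue system of the F-shell -/

section Linearisation

variable {ϖ : K} {σ : K →+* K}

/-- Valuation letter: `|ϖ|^a ≤ |ϖ|^b ↔ b ≤ a` for `|ϖ| = exp(−1)`. [cite: Serre1979, Ch. II §1] -/
theorem v_pow_le_pow_iff (hϖ : Valued.v ϖ = exp (-1 : ℤ)) (a b : ℕ) : Valued.v ϖ ^ a ≤ Valued.v ϖ ^ b ↔ b ≤ a := by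
  rw [v_varpi_pow hϖ, v_varpi_pow hϖ, exp_le_exp]; omega

/-- Valuation letter: `|ϖ|^a < |ϖ|^b ↔ b < a`. [cite: Serre1979, Ch. II §1] -/
theorem v_pow_lt_pow_iff (hϖ : Valued.v ϖ = exp (-1 : ℤ)) (a b : ℕ) : Valued.v ϖ ^ a < Valued.v ϖ ^ b ↔ b < a := by
  rw [v_varpi_pow hϖ, v_varpi_pow hϖ, exp_lt_exp]; omega

/-- **THE KEY LETTER**: if `|g| = |g′| = |ϖ|^s` are `𝔭^n`-irredundant-comparable, `|b|, |b′| ≤ |ϖ|^n` and `|(g + (1+g)b) − (g′ + (1+g′)b′)| ≤ |ϖ|^N` with `1 ≤ s`, `s < n ≤ N`, then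
`|g − g′| ≤ |ϖ|^n` (read modulo `𝔭^n`) and, once `g = g′`, `|b − b′| ≤ |ϖ|^N` (divide by the unit `1 + g`). [cite: Serre1979, Ch. II §1] -/
theorem v_sub_le_and_of_v_linear_sub_le (hϖ : Valued.v ϖ = exp (-1 : ℤ)) {s n N : ℕ} (hs : 1 ≤ s) (hsn : s < n) (hnN : n ≤ N)
    {g g' b b' : K} (hg : Valued.v g = Valued.v ϖ ^ s) (hb : Valued.v b ≤ Valued.v ϖ ^ n) (hb' : Valued.v b' ≤ Valued.v ϖ ^ n)
    (h : Valued.v ((g + (1 + g) * b) - (g' + (1 + g') * b')) ≤ Valued.v ϖ ^ N) :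
    Valued.v (g - g') ≤ Valued.v ϖ ^ n ∧ (g = g' → Valued.v (b - b') ≤ Valued.v ϖ ^ N) := by
  have hnN' : Valued.v ϖ ^ N ≤ Valued.v ϖ ^ n := (v_pow_le_pow_iff hϖ _ _).2 hnN
  have hg1 : Valued.v g < 1 := by
    rw [hg, ← pow_zero (Valued.v ϖ)]; exact (v_pow_lt_pow_iff hϖ _ _).2 (by omega)
  have h1g : Valued.v (1 + g) = 1 := Valued.v.map_one_add_of_lt hg1
  have h1b' : Valued.v (1 + b') ≤ 1 := by
    refine (Valuation.map_add _ _ _).trans (max_le (le_of_eq (map_one _)) (hb'.trans ?_))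
    exact pow_le_one₀ zero_le (by rw [hϖ, ← exp_zero]; exact exp_le_exp.2 (by norm_num))
  -- `(g + (1+g)b) − (g′ + (1+g′)b′) = (g − g′)(1 + b′) + (1 + g)(b − b′)`
  have e : (g + (1 + g) * b) - (g' + (1 + g') * b') = (g - g') * (1 + b') + (1 + g) * (b - b') := by ring
  rw [e] at h
  have hsecond : Valued.v ((1 + g) * (b - b')) ≤ Valued.v ϖ ^ n := by
    rw [map_mul, h1g, one_mul]
    exact (Valuation.map_sub _ _ _).trans (max_le hb hb')
  constructor
  · -- modulo `𝔭^n`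
    have hfirst : Valued.v ((g - g') * (1 + b')) ≤ Valued.v ϖ ^ n := by
      have e2 : (g - g') * (1 + b') = ((g - g') * (1 + b') + (1 + g) * (b - b')) - (1 + g) * (b - b') := by ring
      rw [e2]
      exact (Valuation.map_sub _ _ _).trans (max_le (h.trans hnN') hsecond)
    -- `1 + b′` is a unit (`|b′| < 1`)
    have hb'1 : Valued.v b' < 1 := lt_of_le_of_lt hb' (by rw [← pow_zero (Valued.v ϖ)]; exact (v_pow_lt_pow_iff hϖ _ _).2 (by omega))
    have hu : Valued.v (1 + b') = 1 := Valued.v.map_one_add_of_lt hb'1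
    rw [map_mul, hu, mul_one] at hfirst
    exact hfirst
  · rintro rfl
    rw [sub_self, zero_mul, zero_add, map_mul, h1g, one_mul] at h
    exact h

variable [DecidableEq K]

/-- **L4a (a) THE IMAGE LIES IN THE SHELL**: every `r = g + (1+g)b` with `g ∈ R″`, `b ∈ B` is fixed, `|r| = |ϖ|^s`, `|r + c₀| = |ϖ|^e` (`1 ≤ s`, `s < n`, `e < n`: the `b`-term is deeper than
both reads). [cite: Serre1979, Ch. II §1] [cite: Kottwitz1986BaseChangeUnits, §1 pp. 240–241] -/
theorem glueShell_image_sub (hϖ : Valued.v ϖ = exp (-1 : ℤ)) {s e n : ℕ} (hs : 1 ≤ s) (hsn : s < n) (hen : e < n) {c₀ : K}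
    (R : Finset K) (hR1 : ∀ g ∈ R, σ g = g ∧ Valued.v g = Valued.v ϖ ^ s) (B : Finset K) (hB1 : ∀ b ∈ B, σ b = b ∧ Valued.v b ≤ Valued.v ϖ ^ n) :
    ∀ r ∈ ((R.filter fun g => Valued.v (g + c₀) = Valued.v ϖ ^ e) ×ˢ B).image (fun p : K × K => p.1 + (1 + p.1) * p.2),
      σ r = r ∧ Valued.v r = Valued.v ϖ ^ s ∧ Valued.v (r + c₀) = Valued.v ϖ ^ e := by
  intro r hr
  obtain ⟨⟨g, b⟩, hgb, rfl⟩ := Finset.mem_image.1 hr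
  obtain ⟨hg, hb⟩ := Finset.mem_product.1 hgb
  obtain ⟨hgR, hge⟩ := Finset.mem_filter.1 hg
  obtain ⟨hσg, hvg⟩ := hR1 g hgR
  obtain ⟨hσb, hvb⟩ := hB1 b hb
  have hg1 : Valued.v g < 1 := by rw [hvg, ← pow_zero (Valued.v ϖ)]; exact (v_pow_lt_pow_iff hϖ _ _).2 (by omega)
  have h1g : Valued.v (1 + g) = 1 := Valued.v.map_one_add_of_lt hg1
  have hdeep : Valued.v ((1 + g) * b) ≤ Valued.v ϖ ^ n := by rw [map_mul, h1g, one_mul]; exact hvb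
  refine ⟨by simp only [map_add, map_mul, map_one, hσg, hσb], ?_, ?_⟩
  · dsimp only
    rw [Valuation.map_add_eq_of_lt_left _ (lt_of_le_of_lt hdeep (by rw [hvg]; exact (v_pow_lt_pow_iff hϖ _ _).2 hsn)), hvg]
  · dsimp only
    rw [show g + (1 + g) * b + c₀ = (g + c₀) + (1 + g) * b by ring,
      Valuation.map_add_eq_of_lt_left _ (lt_of_le_of_lt hdeep (by rw [hge]; exact (v_pow_lt_pow_iff hϖ _ _).2 hen)), hge]

/-- **L4a (b) THE IMAGE IS COMPLETE**: every fixed `r` with `|r| = |ϖ|^s`, `|r + c₀| = |ϖ|^e` is `𝔭^N`-close to some `g + (1+g)b`, `g ∈ R″`, `b ∈ B` (`R` complete modulo `𝔭^n`, `B` complete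
modulo `𝔭^N` for the fixed ball `|b| ≤ |ϖ|^n`; `e < n`, `1 ≤ s`): take `g = rep_R(r)` — automatically in the cut — and `b = rep_B((r − g)∕(1 + g))`.
[cite: Serre1979, Ch. II §1] [cite: Kottwitz1986BaseChangeUnits, §1 pp. 240–241] -/
theorem glueShell_image_complete (hϖ : Valued.v ϖ = exp (-1 : ℤ)) {s e n N : ℕ} (hs : 1 ≤ s) (hen : e < n) {c₀ : K}
    (R : Finset K) (hR1 : ∀ g ∈ R, σ g = g ∧ Valued.v g = Valued.v ϖ ^ s)
    (hR2 : ∀ f : K, σ f = f → Valued.v f = Valued.v ϖ ^ s → ∃ g ∈ R, Valued.v (f - g) ≤ Valued.v ϖ ^ n)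
    (B : Finset K) (hB2 : ∀ b : K, σ b = b → Valued.v b ≤ Valued.v ϖ ^ n → ∃ b' ∈ B, Valued.v (b - b') ≤ Valued.v ϖ ^ N) :
    ∀ r : K, σ r = r → Valued.v r = Valued.v ϖ ^ s → Valued.v (r + c₀) = Valued.v ϖ ^ e →
      ∃ x ∈ ((R.filter fun g => Valued.v (g + c₀) = Valued.v ϖ ^ e) ×ˢ B).image (fun p : K × K => p.1 + (1 + p.1) * p.2), Valued.v (r - x) ≤ Valued.v ϖ ^ N := by
  intro r hσr hvr hre
  obtain ⟨g, hgR, hrg⟩ := hR2 r hσr hvr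
  obtain ⟨hσg, hvg⟩ := hR1 g hgR
  have hg1 : Valued.v g < 1 := by rw [hvg, ← pow_zero (Valued.v ϖ)]; exact (v_pow_lt_pow_iff hϖ _ _).2 (by omega)
  have h1g : Valued.v (1 + g) = 1 := Valued.v.map_one_add_of_lt hg1
  have h1g0 : 1 + g ≠ 0 := fun h0 => by rw [h0, map_zero] at h1g; exact zero_ne_one h1g
  -- `g` is in the cut
  have hge : Valued.v (g + c₀) = Valued.v ϖ ^ e := by
    rw [show g + c₀ = (r + c₀) - (r - g) by ring, Valuation.map_sub_eq_of_lt_left _ ?_, hre]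
    rw [hre]; exact lt_of_le_of_lt hrg ((v_pow_lt_pow_iff hϖ _ _).2 hen)
  -- `b₀ = (r − g)∕(1 + g)` is fixed, in the ball
  set b₀ : K := (r - g) / (1 + g) with hb₀
  have hσb₀ : σ b₀ = b₀ := by rw [hb₀, map_div₀, map_sub, map_add, map_one, hσr, hσg]
  have hvb₀ : Valued.v b₀ ≤ Valued.v ϖ ^ n := by rw [hb₀, map_div₀, h1g, div_one]; exact hrg
  obtain ⟨b, hbB, hbb⟩ := hB2 b₀ hσb₀ hvb₀
  refine ⟨g + (1 + g) * b, Finset.mem_image.2 ⟨(g, b), Finset.mem_product.2 ⟨Finset.mem_filter.2 ⟨hgR, hge⟩, hbB⟩, rfl⟩, ?_⟩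
  have e1 : r - (g + (1 + g) * b) = (1 + g) * (b₀ - b) := by rw [hb₀]; field_simp; ring
  rw [e1, map_mul, h1g, one_mul]
  exact hbb

/-- **L4a (c) THE IMAGE IS IRREDUNDANT** modulo `𝔭^N` (`1 ≤ s < n ≤ N`; `R` irredundant modulo `𝔭^n`, `B` irredundant modulo `𝔭^N`). [cite: Serre1979, Ch. II §1] -/
theorem glueShell_image_irredundant (hϖ : Valued.v ϖ = exp (-1 : ℤ)) {s e n N : ℕ} (hs : 1 ≤ s) (hsn : s < n) (hnN : n ≤ N) {c₀ : K}
    (R : Finset K) (hR1 : ∀ g ∈ R, σ g = g ∧ Valued.v g = Valued.v ϖ ^ s) (hR3 : ∀ g ∈ R, ∀ g' ∈ R, Valued.v (g - g') ≤ Valued.v ϖ ^ n → g = g')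
    (B : Finset K) (hB1 : ∀ b ∈ B, σ b = b ∧ Valued.v b ≤ Valued.v ϖ ^ n) (hB3 : ∀ b ∈ B, ∀ b' ∈ B, Valued.v (b - b') ≤ Valued.v ϖ ^ N → b = b') :
    ∀ x ∈ ((R.filter fun g => Valued.v (g + c₀) = Valued.v ϖ ^ e) ×ˢ B).image (fun p : K × K => p.1 + (1 + p.1) * p.2),
      ∀ x' ∈ ((R.filter fun g => Valued.v (g + c₀) = Valued.v ϖ ^ e) ×ˢ B).image (fun p : K × K => p.1 + (1 + p.1) * p.2),
        Valued.v (x - x') ≤ Valued.v ϖ ^ N → x = x' := by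
  intro x hx x' hx' hxx'
  obtain ⟨⟨g, b⟩, hgb, rfl⟩ := Finset.mem_image.1 hx
  obtain ⟨⟨g', b'⟩, hgb', rfl⟩ := Finset.mem_image.1 hx'
  obtain ⟨hg, hb⟩ := Finset.mem_product.1 hgb
  obtain ⟨hg', hb'⟩ := Finset.mem_product.1 hgb'
  have hgR := (Finset.mem_filter.1 hg).1
  have hgR' := (Finset.mem_filter.1 hg').1
  obtain ⟨hgg', hbb'⟩ := v_sub_le_and_of_v_linear_sub_le hϖ hs hsn hnN (hR1 g hgR).2 (hB1 b hb).2 (hB1 b' hb').2 hxx'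
  have hgeq : g = g' := hR3 g hgR g' hgR' hgg'
  have hbeq : b = b' := hB3 b hb b' hb' (hbb' hgeq)
  subst hgeq; subst hbeq; rfl

omit [DecidableEq K] in
/-- **L4a (d) THE MAP IS INJECTIVE ON `R″ ×ˢ B`** (`1 ≤ s < n ≤ N`). [cite: Serre1979, Ch. II §1] -/
theorem glueShell_injOn (hϖ : Valued.v ϖ = exp (-1 : ℤ)) {s e n N : ℕ} (hs : 1 ≤ s) (hsn : s < n) (hnN : n ≤ N) {c₀ : K}
    (R : Finset K) (hR1 : ∀ g ∈ R, σ g = g ∧ Valued.v g = Valued.v ϖ ^ s) (hR3 : ∀ g ∈ R, ∀ g' ∈ R, Valued.v (g - g') ≤ Valued.v ϖ ^ n → g = g')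
    (B : Finset K) (hB1 : ∀ b ∈ B, σ b = b ∧ Valued.v b ≤ Valued.v ϖ ^ n) (hB3 : ∀ b ∈ B, ∀ b' ∈ B, Valued.v (b - b') ≤ Valued.v ϖ ^ N → b = b') :
    Set.InjOn (fun p : K × K => p.1 + (1 + p.1) * p.2) ↑((R.filter fun g => Valued.v (g + c₀) = Valued.v ϖ ^ e) ×ˢ B) := by
  rintro ⟨g, b⟩ hgb ⟨g', b'⟩ hgb' heq
  rw [Finset.mem_coe, Finset.mem_product] at hgb hgb'
  have hgR := (Finset.mem_filter.1 hgb.1).1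
  have hgR' := (Finset.mem_filter.1 hgb'.1).1
  have hxx' : Valued.v ((g + (1 + g) * b) - (g' + (1 + g') * b')) ≤ Valued.v ϖ ^ N := by
    have heq' : g + (1 + g) * b = g' + (1 + g') * b' := heq
    rw [heq', sub_self, map_zero]; exact zero_le
  obtain ⟨hgg', hbb'⟩ := v_sub_le_and_of_v_linear_sub_le hϖ hs hsn hnN (hR1 g hgR).2 (hB1 b hgb.2).2 (hB1 b' hgb'.2).2 hxx'
  have hgeq : g = g' := hR3 g hgR g' hgR' hgg'
  have hbeq : b = b' := hB3 b hgb.2 b' hgb'.2 (hbb' hgeq)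
  rw [hgeq, hbeq]

/-- **L4a (e) THE WINDOW DOUBLE SUM IS A SINGLE SUM OVER THE SHELL SYSTEM**: for every `G`, `Σ_{g ∈ R″} Σ_{b ∈ B} G(g + (1+g)b) = Σ_{r ∈ S} G(r)`, `S = (R″ ×ˢ B).image (g + (1+g)b)`
(`Finset.sum_product` + `Finset.sum_image` on the injectivity (d)). [cite: Serre1979, Ch. II §1] [cite: Kottwitz1986BaseChangeUnits, §1 pp. 240–241] -/
theorem sum_sum_glueShell_eq_sum_image {M : Type} [AddCommMonoid M] (hϖ : Valued.v ϖ = exp (-1 : ℤ)) {s e n N : ℕ} (hs : 1 ≤ s) (hsn : s < n) (hnN : n ≤ N) {c₀ : K}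
    (R : Finset K) (hR1 : ∀ g ∈ R, σ g = g ∧ Valued.v g = Valued.v ϖ ^ s) (hR3 : ∀ g ∈ R, ∀ g' ∈ R, Valued.v (g - g') ≤ Valued.v ϖ ^ n → g = g')
    (B : Finset K) (hB1 : ∀ b ∈ B, σ b = b ∧ Valued.v b ≤ Valued.v ϖ ^ n) (hB3 : ∀ b ∈ B, ∀ b' ∈ B, Valued.v (b - b') ≤ Valued.v ϖ ^ N → b = b')
    (G : K → M) :
    ∑ g ∈ R.filter (fun g => Valued.v (g + c₀) = Valued.v ϖ ^ e), ∑ b ∈ B, G (g + (1 + g) * b) =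
      ∑ r ∈ ((R.filter fun g => Valued.v (g + c₀) = Valued.v ϖ ^ e) ×ˢ B).image (fun p : K × K => p.1 + (1 + p.1) * p.2), G r := by
  rw [Finset.sum_image (glueShell_injOn hϖ hs hsn hnN R hR1 hR3 B hB1 hB3), Finset.sum_product]

end Linearisation

/-! ## §3  L3c — the `aγ`-invisibility -/

section Invisibility

variable {σ : K →+* K} {ϖ : K} {d t : ℕ}

/-- **`ω(x + y) = ω(x)` FOR A RELATIVELY DEEP PERTURBATION**: `x` fixed non-zero, `y` fixed, `|y| ≤ |ϖ|^n·|x|` with `n ≥ 2d − 1` (`x + y = x·(1 + y∕x)`, and `1 + y∕x ∈ U_F(n)` is a norm —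
★ `normSign_mul_eq_of_fixed_of_v_sub_one_le`). [cite: Serre1979, Ch. XV §2] -/
theorem normSign_add_eq_of_v_le [CompleteSpace K] (hD : IsRamifiedQuadraticDatum σ ϖ d t) {x y : K} (hσx : σ x = x) (hσy : σ y = y) (hx0 : x ≠ 0)
    {n : ℕ} (hn : 2 * d - 1 ≤ n) (h : Valued.v y ≤ Valued.v ϖ ^ n * Valued.v x) : normSign σ (x + y) = normSign σ x := by
  have e : x + y = x * (1 + y / x) := by field_simp
  have hσq : σ (1 + y / x) = 1 + y / x := by rw [map_add, map_one, map_div₀, hσx, hσy]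
  have hxpos : 0 < Valued.v x := (Valuation.pos_iff _).2 hx0
  have hq : Valued.v (1 + y / x - 1) ≤ Valued.v ϖ ^ n := by
    rw [add_sub_cancel_left, map_div₀, div_eq_mul_inv, mul_inv_le_iff₀ hxpos]
    exact h
  rw [e, normSign_mul_eq_of_fixed_of_v_sub_one_le hD x hσq hn hq]

/-- **`ω(a) = 1` ON `U_F^{[k]}`, `k ≥ 2d − 1`** (★ toolkit §3, restated with the membership letters of ★ PT-3's `Aγ`: `σa = a`, `|a − 1| ≤ |ϖ|^k`). [cite: Serre1979, Ch. XV §2] -/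
theorem normSign_eq_one_of_mem_deep [CompleteSpace K] (hD : IsRamifiedQuadraticDatum σ ϖ d t) {k : ℕ} (hk : 2 * d - 1 ≤ k)
    {a : K} (hσa : σ a = a) (ha : Valued.v (a - 1) ≤ Valued.v ϖ ^ k) : normSign σ a = 1 :=
  normSign_eq_one_of_fixed_of_v_sub_one_le hD hσa hk ha

/-- **THE `aγ`-PERTURBATION OF THE LABEL ARGUMENT IS INVISIBLE**: for `x` fixed non-zero and `z` fixed with `|z| ≤ |x|`, every fixed `a` with `|a − 1| ≤ |ϖ|^k`, `k ≥ 2d − 1`, has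
`ω(x + (a − 1)·z) = ω(x)` — the shape `ω(g g_α + (aγ∕T) g_β) = ω(g g_α + g_β∕T)` of ROADMAP §1 (L3c) with `x = g g_α + g_β∕T`, `z = g_β∕T` (there `|z| = |x|·|ϖ|^{−E} · …` is NOT
`≤ |x|`; use `normSign_add_eq_of_v_le` directly with the depth `2ρ − E ≥ 2d − 1` — this head is the `|z| ≤ |x|` convenience case). [cite: Serre1979, Ch. XV §2] -/
theorem normSign_add_mul_eq_of_mem_deep [CompleteSpace K] (hD : IsRamifiedQuadraticDatum σ ϖ d t) {k : ℕ} (hk : 2 * d - 1 ≤ k)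
    {x z a : K} (hσx : σ x = x) (hσz : σ z = z) (hσa : σ a = a) (hx0 : x ≠ 0) (hz : Valued.v z ≤ Valued.v x) (ha : Valued.v (a - 1) ≤ Valued.v ϖ ^ k) :
    normSign σ (x + (a - 1) * z) = normSign σ x := by
  refine normSign_add_eq_of_v_le hD hσx (by rw [map_mul, map_sub, map_one, hσa, hσz]) hx0 hk ?_
  rw [map_mul]
  exact mul_le_mul' ha hz

omit [Field K] [Valued K ℤᵐ⁰] in
/-- **AN `aγ`-BLIND SUMMAND SUMS TO `#Aγ ·` ITS VALUE**: if `f a = f a₀` for all `a ∈ A` then `Σ_{a ∈ A} f a = #A · f a₀`. [folklore] -/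
theorem sum_eq_card_mul_of_forall_eq {M : Type} [AddCommMonoid M] (A : Finset K) (f : K → M) (m : M) (hf : ∀ a ∈ A, f a = m) :
    ∑ a ∈ A, f a = A.card • m := by
  rw [Finset.sum_congr rfl hf, Finset.sum_const]

end Invisibility

end Summit.HodgeConjecture.HodgeConjecture.Cruxes.H413.F0P3cDyRamGlueShellLinearisation

end
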